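import Summits.QuantumFields.YangMills.Theorems.BalabanUVNodesPortS1CfgPiecesW
import Summits.QuantumFields.YangMills.Theorems.BalabanUVNodesPortS1JacRepresents
import Summits.QuantumFields.YangMills.Theorems.BalabanUVNodesK0RecordFormatNamesLDress

/-!
# NODE O port PT-A — THE `B`-LEVEL ADAPTER «torus-level localized pieces + a germ identity in `B` ⟹ wrap-aware residue» (the packaging step of the v3.3 glue `lzdetHalf_of_P0C_G3C` of 27930's line
# `pta_residueW`; the Gaussian bracket `phiLZdet` is given as a function of `B`, and its (63) representation holds EVENTUALLY in `B`, not as a configuration-level identity)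

Cell `ym-nodeO-ideate`, porter seat `ymgap-nodeO-port-PTA-1` (gen 7); `--supports stmt-QuantumFields-27930` (helper, P0-free).  [I] = [Balaban1987RG1], [16] = [Balaban1985UV3].
Twin of gen 3's ✓`residueAtW_of_cfgPieces` (`…PortS1CfgPiecesW`, configuration-level identity on a small-field ball) for functionals handed over as GERMS IN `B`:
* §1 ★★ `residueAtW_of_piecesB` — torus-level pieces `E n X` with rows (a)(b)(c)(d) at every domain, off-wrap members = pull-back pieces of ONE integer formula `Ψ`, and the identity
  `Φ n B = Σ_X E n X (pair of U_{k+1}(W_B) cut to X)` EVENTUALLY at `B = 0` ⟹ `Ψ.ResidueAtW F Mc k E … Φ`.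
* §2 ★ `eventually_sum_pieces_cut_eq` — (1.7) locality turns the UNCUT germ identity `Φ n B = Σ_X E n X (recordPairJ … B)` into the cut one (✓`agreeOnSet_pairCutTorusAt`); ★★ `residueAtW_of_piecesJ` = §1 ∘ §2.

HONEST FRAMING.  Plumbing over DEF-1 ed.13c's names; NO expansion of Bałaban's constructed or asserted; `stub_LZdet` ∕ `stub_FE` OPEN; 27930 OPEN · 2∕4 stubs by name · no claim; NODE O 0∕1; COUNT 8∕28 · K 1∕4
UNMOVED; finite `𝕋⁴_{L^K}` at fixed ε — NOT continuum ∕ OS ∕ Clay; **the Yang–Mills mass gap is NOT proved by any of this.**  No `sorry`, no `def`, no `instance`; standard axioms.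
-/

noncomputable section

open scoped BigOperators Matrix.Norms.L2Operator Topology

namespace Summit.QuantumFields.YangMills.Theorems.BalabanUVNodesPortS1

open Summit.QuantumFields.YangMills.Theorems.K0RecordFormatNames
open Literature.MathematicalPhysics.QuantumFieldTheory.Balaban1983to89
open Literature.MathematicalPhysics.QuantumFieldTheory.Balaban1983to89.Node00
open Literature.MathematicalPhysics.QuantumFieldTheory.Balaban1983to89.T4Continuum (T4Family)
open _root_.Filter

variable (F : T4Family)

/-! ## §1  Pieces + a `B`-germ identity ⟹ the wrap-aware residue -/

open scoped Classical in
/-- ★★ **TORUS-LEVEL PIECES + THE CUT GERM IDENTITY ⟹ WRAP-AWARE RESIDUE.**  Data at every volume `K₀ + n`: pieces `E n X : Sect2.CPair → ℂ` for EVERY domain `X` with (a) analyticity and (b) the (1.18)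
bound on the record spaces, (c) (1.7) locality, (d) (1.19) invariance under `recordGaugeGrp`; the OFF-WRAP pieces are the pull-back pieces of ONE `Ψ`; and `Φ n B = Σ_X E n X (pair of U_{k+1}(W_B) cut to X)`
eventually at `B = 0`.  Then `Ψ.ResidueAtW F Mc k E a₀ ε₂₉ α₀ α₁ E₀ κ Φ`. [cite: Balaban1987RG1, (1.6)–(1.9) p.261, (1.18)–(1.19) p.263, (1.21) p.264; Balaban1985UV3, (63) p.272] -/
theorem residueAtW_of_piecesB (Mc k : ℕ) (a₀ ε₂₉ α₀ α₁ E₀ κ : ℝ) (Ψ : IntLocalFormula (F.L ^ (k + 1) * Mc)) (E : TorusPieces F Mc k)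
    (Φ : (n : ℕ) → recordW F a₀ ε₂₉ k (recordK₀ F Mc k + n) → ℂ)
    (hEΨ : ∀ n (X : (recordDomSys F Mc k (recordK₀ F Mc k + n)).Dom), X ∉ recordWrapCtr F Mc k (recordK₀ F Mc k + n) →
      ∀ φ, E n X φ = Ψ.Ψ.piece F Mc k (recordK₀ F Mc k + n) X φ)
    (hEA : ∀ n (X : (recordDomSys F Mc k (recordK₀ F Mc k + n)).Dom) (φ : Sect2.CPair (F.P (recordK₀ F Mc k + n)) (MatA 2)),
      encodeCfg F (recordK₀ F Mc k + n) φ ∈ recordUc F Mc k α₀ α₁ (recordK₀ F Mc k + n) X → AnalyticAt ℂ (E n X) φ)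
    (hEB : ∀ n (X : (recordDomSys F Mc k (recordK₀ F Mc k + n)).Dom) (φ : Sect2.CPair (F.P (recordK₀ F Mc k + n)) (MatA 2)),
      encodeCfg F (recordK₀ F Mc k + n) φ ∈ recordUc F Mc k α₀ α₁ (recordK₀ F Mc k + n) X →
        ‖E n X φ‖ ≤ E₀ * Real.exp (-κ * (recordDomSys F Mc k (recordK₀ F Mc k + n)).dj X))
    (hEL : ∀ n (X : (recordDomSys F Mc k (recordK₀ F Mc k + n)).Dom) (φ ψ : Sect2.CPair (F.P (recordK₀ F Mc k + n)) (MatA 2)),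
      Sect2.agreeOnSet (Sect2.domSites (F.P (recordK₀ F Mc k + n)) Mc (k + 1) X) φ ψ → E n X φ = E n X ψ)
    (hEG : ∀ n (X : (recordDomSys F Mc k (recordK₀ F Mc k + n)).Dom) (u : recordGaugeGrp F (recordK₀ F Mc k + n)) φ, E n X (Sect2.cAct u.1 φ) = E n X φ)
    (hrep : ∀ n, letI θ := thetaFill F a₀ ε₂₉; letI := θ.instVβ₁; letI := θ.instVβ₂; letI := θ.instιβ
      ∀ᶠ B in 𝓝 (0 : recordW F a₀ ε₂₉ k (recordK₀ F Mc k + n)),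
        Φ n B = ∑ X : (recordDomSys F Mc k (recordK₀ F Mc k + n)).Dom, E n X (pairCutTorusAt F a₀ ε₂₉ Mc k (recordK₀ F Mc k + n) X B)) :
    Ψ.ResidueAtW F Mc k E a₀ ε₂₉ α₀ α₁ E₀ κ Φ := by
  refine ⟨fun n X hX φ hφ => ?_, fun n X hX φ hφ => ?_, fun n X _ φ hφ => hEA n X φ hφ, fun n X _ φ hφ => hEB n X φ hφ,
    fun n X _ φ ψ hag => hEL n X φ ψ hag, fun n X _ u φ => hEG n X u φ, fun n => ?_⟩
  · have hfun : (fun ψ => Ψ.Ψ.piece F Mc k (recordK₀ F Mc k + n) X ψ) = E n X := funext fun ψ => (hEΨ n X hX ψ).symm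
    rw [hfun]
    exact hEA n X φ hφ
  · rw [← hEΨ n X hX φ]
    exact hEB n X φ hφ
  · letI θ := thetaFill F a₀ ε₂₉; letI := θ.instVβ₁; letI := θ.instVβ₂; letI := θ.instιβ
    filter_upwards [hrep n] with B hB
    rw [hB]
    refine Finset.sum_congr rfl fun X _ => ?_
    by_cases hX : X ∈ recordWrapCtr F Mc k (recordK₀ F Mc k + n)
    · rw [if_pos hX]
    · rw [if_neg hX, pairCutAt_eq_pullPair_pairCutTorusAt]
      exact hEΨ n X hX _

/-! ## §2  The uncut germ identity suffices (locality) -/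

/-- ★ **LOCALITY CUTS THE PAIR**: if every piece `E n X` reads the pair only through the sites of `X`, the UNCUT identity `Φ n B = Σ_X E n X (recordPairJ … B)` (eventually) IS the cut identity of §1.
[cite: Balaban1987RG1, (1.7)–(1.9) p.261] -/
theorem eventually_sum_pieces_cut_eq (Mc k : ℕ) (a₀ ε₂₉ : ℝ) (E : TorusPieces F Mc k)
    (Φ : (n : ℕ) → recordW F a₀ ε₂₉ k (recordK₀ F Mc k + n) → ℂ)
    (hEL : ∀ n (X : (recordDomSys F Mc k (recordK₀ F Mc k + n)).Dom) (φ ψ : Sect2.CPair (F.P (recordK₀ F Mc k + n)) (MatA 2)),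
      Sect2.agreeOnSet (Sect2.domSites (F.P (recordK₀ F Mc k + n)) Mc (k + 1) X) φ ψ → E n X φ = E n X ψ)
    (hrepJ : ∀ n, letI θ := thetaFill F a₀ ε₂₉; letI := θ.instVβ₁; letI := θ.instVβ₂; letI := θ.instιβ
      ∀ᶠ B in 𝓝 (0 : recordW F a₀ ε₂₉ k (recordK₀ F Mc k + n)),
        Φ n B = ∑ X : (recordDomSys F Mc k (recordK₀ F Mc k + n)).Dom, E n X (recordPairJ F θ k (recordK₀ F Mc k + n) B)) (n : ℕ) :
    letI θ := thetaFill F a₀ ε₂₉; letI := θ.instVβ₁; letI := θ.instVβ₂; letI := θ.instιβ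
    ∀ᶠ B in 𝓝 (0 : recordW F a₀ ε₂₉ k (recordK₀ F Mc k + n)),
      Φ n B = ∑ X : (recordDomSys F Mc k (recordK₀ F Mc k + n)).Dom, E n X (pairCutTorusAt F a₀ ε₂₉ Mc k (recordK₀ F Mc k + n) X B) := by
  letI θ := thetaFill F a₀ ε₂₉; letI := θ.instVβ₁; letI := θ.instVβ₂; letI := θ.instιβ
  filter_upwards [hrepJ n] with B hB
  rw [hB]
  refine Finset.sum_congr rfl fun X _ => hEL n X _ _ ?_
  exact agreeOnSet_pairCutTorusAt a₀ ε₂₉ Mc k (recordK₀ F Mc k + n) X B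

open scoped Classical in
/-- ★★ **PIECES + THE UNCUT GERM IDENTITY ⟹ WRAP-AWARE RESIDUE** (§1 after §2). [cite: Balaban1987RG1, (1.6)–(1.9) p.261, (1.18)–(1.19) p.263, (1.21) p.264; Balaban1985UV3, (63) p.272] -/
theorem residueAtW_of_piecesJ (Mc k : ℕ) (a₀ ε₂₉ α₀ α₁ E₀ κ : ℝ) (Ψ : IntLocalFormula (F.L ^ (k + 1) * Mc)) (E : TorusPieces F Mc k)
    (Φ : (n : ℕ) → recordW F a₀ ε₂₉ k (recordK₀ F Mc k + n) → ℂ)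
    (hEΨ : ∀ n (X : (recordDomSys F Mc k (recordK₀ F Mc k + n)).Dom), X ∉ recordWrapCtr F Mc k (recordK₀ F Mc k + n) →
      ∀ φ, E n X φ = Ψ.Ψ.piece F Mc k (recordK₀ F Mc k + n) X φ)
    (hEA : ∀ n (X : (recordDomSys F Mc k (recordK₀ F Mc k + n)).Dom) (φ : Sect2.CPair (F.P (recordK₀ F Mc k + n)) (MatA 2)),
      encodeCfg F (recordK₀ F Mc k + n) φ ∈ recordUc F Mc k α₀ α₁ (recordK₀ F Mc k + n) X → AnalyticAt ℂ (E n X) φ)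
    (hEB : ∀ n (X : (recordDomSys F Mc k (recordK₀ F Mc k + n)).Dom) (φ : Sect2.CPair (F.P (recordK₀ F Mc k + n)) (MatA 2)),
      encodeCfg F (recordK₀ F Mc k + n) φ ∈ recordUc F Mc k α₀ α₁ (recordK₀ F Mc k + n) X →
        ‖E n X φ‖ ≤ E₀ * Real.exp (-κ * (recordDomSys F Mc k (recordK₀ F Mc k + n)).dj X))
    (hEL : ∀ n (X : (recordDomSys F Mc k (recordK₀ F Mc k + n)).Dom) (φ ψ : Sect2.CPair (F.P (recordK₀ F Mc k + n)) (MatA 2)),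
      Sect2.agreeOnSet (Sect2.domSites (F.P (recordK₀ F Mc k + n)) Mc (k + 1) X) φ ψ → E n X φ = E n X ψ)
    (hEG : ∀ n (X : (recordDomSys F Mc k (recordK₀ F Mc k + n)).Dom) (u : recordGaugeGrp F (recordK₀ F Mc k + n)) φ, E n X (Sect2.cAct u.1 φ) = E n X φ)
    (hrepJ : ∀ n, letI θ := thetaFill F a₀ ε₂₉; letI := θ.instVβ₁; letI := θ.instVβ₂; letI := θ.instιβ
      ∀ᶠ B in 𝓝 (0 : recordW F a₀ ε₂₉ k (recordK₀ F Mc k + n)),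
        Φ n B = ∑ X : (recordDomSys F Mc k (recordK₀ F Mc k + n)).Dom, E n X (recordPairJ F θ k (recordK₀ F Mc k + n) B)) :
    Ψ.ResidueAtW F Mc k E a₀ ε₂₉ α₀ α₁ E₀ κ Φ :=
  residueAtW_of_piecesB F Mc k a₀ ε₂₉ α₀ α₁ E₀ κ Ψ E Φ hEΨ hEA hEB hEL hEG
    (fun n => eventually_sum_pieces_cut_eq F Mc k a₀ ε₂₉ E Φ hEL hrepJ n)

end Summit.QuantumFields.YangMills.Theorems.BalabanUVNodesPortS1

end
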